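import Summits.QuantumFields.QCD.Theorems.HeatSlicedQuarksQuarkLoopCoefficientFreeHeatCalculusAuxB

/-!
# Free heat calculus on `ℤ⁴`, part D: the Brillouin-zone kernel
(line `Sketch` of crux stmt-QuantumFields-16786, helper file of the stub `stub_freeHeatCalculus`)

The free heat kernel `freeKer t w = (2π)⁻⁴ ∫_{[−π,π]⁴} e^{−t h(p)} cos(p·w) dp` of
`HeatSlicedQuarksQuarkLoopCoefficientDefs`:

* the Brillouin zone: volume `(2π)⁴`; continuity, integrability and the bounds `|k_t(w)| ≤ e^{68|t|}`, `|k_t(w)| ≤ 1 (t ≥ 0)`;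
* evenness `k_t(−w) = k_t(w)` (conjunct (7) of `FreeHeatCalculus`);
* the initial value `k_0 = δ₀` (conjunct (3)): `∫_{[−π,π]⁴} e^{ip·w} dp = (2π)⁴ [w = 0]` by Fubini over
  the four coordinates and the one-dimensional exponential integral;
* the lattice heat equation `∂_t k_t(w) = −Σ_{z ∈ nbr2 0} ĥ(z) k_t(w − z)` (conjunct (4)):
  differentiation under the integral sign and the symbol identity `hsymb_mul_cos` of part B.
-/

noncomputable section

namespace Summit.QuantumFields.QCD.Cruxes.QuarkLoopCoefficient.Sketch.FreeHeatCalculus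

open Literature.MathematicalPhysics.QuantumLattice Literature.MathematicalPhysics.QuantumFieldTheory
open Literature.Probability.LatticeModels (Site)
open Summit.QuantumFields.QCD.Theorems.QuarkLoopCoefficient
open Summit.QuantumFields.QCD.Cruxes.QuarkLoopCoefficient.Sketch.HeatSeries
open MeasureTheory
open scoped Matrix ComplexConjugate
-- Brillouin-zone and symbol basics reused from the landed `…SecondOrderCoefficientAuxE`.
open Summit.QuantumFields.QCD.Cruxes.QuarkLoopCoefficient.Sketch.SecondOrderCoefficient
  (hsymb_nonneg continuous_hsymb measurableSet_brillouin isCompact_brillouin volume_brillouin_lt_top)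

/-! ## §1 The Brillouin zone -/

/-- The Brillouin zone as a product of intervals. -/
theorem brillouin_eq : brillouin = Set.pi Set.univ (fun _ : Fin 4 => Set.Icc (-Real.pi) Real.pi) := rfl

/-- The volume of the Brillouin zone is `(2π)⁴`. -/
theorem volume_brillouin : volume brillouin = ENNReal.ofReal (2 * Real.pi) ^ 4 := by
  rw [brillouin_eq, volume_pi_pi]
  simp only [Real.volume_Icc, Finset.prod_const, Finset.card_univ, Fintype.card_fin]
  rw [show Real.pi - -Real.pi = 2 * Real.pi by ring]

/-- The real volume of the Brillouin zone is `(2π)⁴`. -/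
theorem volume_real_brillouin : volume.real brillouin = (2 * Real.pi) ^ 4 := by
  rw [measureReal_def, volume_brillouin, ENNReal.toReal_pow, ENNReal.toReal_ofReal (by positivity)]

/-- The normalisation: `(2π)⁻⁴ · (2π)⁴ = 1`. -/
theorem norm_const_mul_volume : ((2 * Real.pi)⁻¹) ^ 4 * (2 * Real.pi) ^ 4 = 1 := by
  rw [← mul_pow, inv_mul_cancel₀ (by positivity), one_pow]

/-- The normalisation constant is positive. -/
theorem norm_const_pos : 0 < ((2 * Real.pi)⁻¹) ^ 4 := by positivity

/-! ## §2 The integrand -/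

/-- The lattice phase `p ↦ p·w` is continuous. -/
theorem continuous_dot (w : Site 4) : Continuous fun p : Fin 4 → ℝ => ∑ μ : Fin 4, p μ * ((w μ : ℤ) : ℝ) := by
  fun_prop

/-- The integrand of the free kernel is continuous. -/
theorem continuous_freeIntegrand (t : ℝ) (w : Site 4) :
    Continuous fun p : Fin 4 → ℝ =>
      Real.exp (-(t * hsymb p)) * Real.cos (∑ μ : Fin 4, p μ * ((w μ : ℤ) : ℝ)) := by
  have := continuous_hsymb
  fun_prop

/-- The integrand of the free kernel is integrable on the Brillouin zone. -/
theorem integrableOn_freeIntegrand (t : ℝ) (w : Site 4) :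
    IntegrableOn (fun p : Fin 4 → ℝ =>
      Real.exp (-(t * hsymb p)) * Real.cos (∑ μ : Fin 4, p μ * ((w μ : ℤ) : ℝ))) brillouin volume :=
  (continuous_freeIntegrand t w).continuousOn.integrableOn_compact isCompact_brillouin

/-- The exponential weight is bounded by `e^{68|t|}`. -/
theorem exp_neg_mul_hsymb_le (t : ℝ) (p : Fin 4 → ℝ) : Real.exp (-(t * hsymb p)) ≤ Real.exp (68 * |t|) := by
  rw [Real.exp_le_exp]
  calc -(t * hsymb p) ≤ |t * hsymb p| := neg_le_abs _
    _ = |t| * hsymb p := by rw [abs_mul, abs_of_nonneg (hsymb_nonneg p)]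
    _ ≤ |t| * 68 := mul_le_mul_of_nonneg_left (hsymb_le p) (abs_nonneg t)
    _ = 68 * |t| := mul_comm _ _

/-- For `t ≥ 0` the exponential weight is bounded by `1`. -/
theorem exp_neg_mul_hsymb_le_one {t : ℝ} (ht : 0 ≤ t) (p : Fin 4 → ℝ) : Real.exp (-(t * hsymb p)) ≤ 1 := by
  rw [Real.exp_le_one_iff, neg_nonpos]
  exact mul_nonneg ht (hsymb_nonneg p)

/-- Pointwise bound of the integrand. -/
theorem abs_freeIntegrand_le (t : ℝ) (w : Site 4) (p : Fin 4 → ℝ) :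
    |Real.exp (-(t * hsymb p)) * Real.cos (∑ μ : Fin 4, p μ * ((w μ : ℤ) : ℝ))| ≤ Real.exp (68 * |t|) := by
  rw [abs_mul, Real.abs_exp]
  calc Real.exp (-(t * hsymb p)) * |Real.cos (∑ μ : Fin 4, p μ * ((w μ : ℤ) : ℝ))|
      ≤ Real.exp (-(t * hsymb p)) * 1 :=
        mul_le_mul_of_nonneg_left (Real.abs_cos_le_one _) (Real.exp_pos _).le
    _ ≤ Real.exp (68 * |t|) := by rw [mul_one]; exact exp_neg_mul_hsymb_le t p

/-- Pointwise bound of the integrand for `t ≥ 0`. -/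
theorem abs_freeIntegrand_le_one {t : ℝ} (ht : 0 ≤ t) (w : Site 4) (p : Fin 4 → ℝ) :
    |Real.exp (-(t * hsymb p)) * Real.cos (∑ μ : Fin 4, p μ * ((w μ : ℤ) : ℝ))| ≤ 1 := by
  rw [abs_mul, Real.abs_exp]
  calc Real.exp (-(t * hsymb p)) * |Real.cos (∑ μ : Fin 4, p μ * ((w μ : ℤ) : ℝ))|
      ≤ 1 * 1 := mul_le_mul (exp_neg_mul_hsymb_le_one ht p) (Real.abs_cos_le_one _) (abs_nonneg _) zero_le_one
    _ = 1 := mul_one 1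

/-- **Crude bound** `|k_t(w)| ≤ e^{68|t|}`. -/
theorem abs_freeKer_le (t : ℝ) (w : Site 4) : |freeKer t w| ≤ Real.exp (68 * |t|) := by
  unfold freeKer
  rw [abs_mul, abs_of_pos norm_const_pos]
  have h := norm_setIntegral_le_of_norm_le_const volume_brillouin_lt_top
    (fun p _ => (Real.norm_eq_abs _).le.trans (abs_freeIntegrand_le t w p))
  rw [Real.norm_eq_abs, volume_real_brillouin] at h
  calc ((2 * Real.pi)⁻¹) ^ 4 * |∫ p in brillouin,
        Real.exp (-(t * hsymb p)) * Real.cos (∑ μ : Fin 4, p μ * ((w μ : ℤ) : ℝ))|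
      ≤ ((2 * Real.pi)⁻¹) ^ 4 * (Real.exp (68 * |t|) * (2 * Real.pi) ^ 4) :=
        mul_le_mul_of_nonneg_left h norm_const_pos.le
    _ = Real.exp (68 * |t|) := by
        rw [mul_comm (Real.exp _), ← mul_assoc, norm_const_mul_volume, one_mul]

/-- **Bound for `t ≥ 0`**: `|k_t(w)| ≤ 1`. -/
theorem abs_freeKer_le_one {t : ℝ} (ht : 0 ≤ t) (w : Site 4) : |freeKer t w| ≤ 1 := by
  unfold freeKer
  rw [abs_mul, abs_of_pos norm_const_pos]
  have h := norm_setIntegral_le_of_norm_le_const volume_brillouin_lt_top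
    (fun p _ => (Real.norm_eq_abs _).le.trans (abs_freeIntegrand_le_one ht w p))
  rw [Real.norm_eq_abs, volume_real_brillouin] at h
  calc ((2 * Real.pi)⁻¹) ^ 4 * |∫ p in brillouin,
        Real.exp (-(t * hsymb p)) * Real.cos (∑ μ : Fin 4, p μ * ((w μ : ℤ) : ℝ))|
      ≤ ((2 * Real.pi)⁻¹) ^ 4 * (1 * (2 * Real.pi) ^ 4) := mul_le_mul_of_nonneg_left h norm_const_pos.le
    _ = 1 := by rw [one_mul, norm_const_mul_volume]

/-! ## §3 Evenness -/

/-- **Evenness** `k_t(−w) = k_t(w)` (conjunct (7) of `FreeHeatCalculus`). -/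
theorem freeKer_neg (t : ℝ) (w : Site 4) : freeKer t (-w) = freeKer t w := by
  unfold freeKer
  simp only [Pi.neg_apply, Int.cast_neg, mul_neg, Finset.sum_neg_distrib, Real.cos_neg]

/-! ## §4 The initial value `k_0 = δ₀` -/

/-- The one-dimensional exponential integral over a period:
`∫_{−π}^{π} e^{i n x} dx = 2π [n = 0]` for an integer `n`. -/
theorem integral_Icc_cexp_mul_int (n : ℤ) :
    ∫ x in Set.Icc (-Real.pi) Real.pi, Complex.exp ((((x * (n : ℝ)) : ℝ) : ℂ) * Complex.I) =
      if n = 0 then (((2 * Real.pi : ℝ)) : ℂ) else 0 := by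
  split_ifs with hn
  · subst hn
    simp only [Int.cast_zero, mul_zero, Complex.ofReal_zero, zero_mul, Complex.exp_zero]
    rw [setIntegral_const, Real.volume_real_Icc_of_le (by linarith [Real.pi_pos]), Complex.real_smul, mul_one]
    push_cast; ring
  · rw [integral_Icc_eq_integral_Ioc, ← intervalIntegral.integral_of_le (by linarith [Real.pi_pos])]
    have hfun : (fun x : ℝ => Complex.exp ((((x * (n : ℝ)) : ℝ) : ℂ) * Complex.I)) =
        fun x : ℝ => Complex.exp (((n : ℂ) * Complex.I) * (x : ℂ)) := by
      funext x; congr 1; push_cast; ring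
    have hc : (n : ℂ) * Complex.I ≠ 0 := mul_ne_zero (by exact_mod_cast hn) Complex.I_ne_zero
    rw [hfun, integral_exp_mul_complex hc, div_eq_zero_iff]
    left
    rw [sub_eq_zero]
    have h := Complex.exp_int_mul_two_pi_mul_I n
    calc Complex.exp ((n : ℂ) * Complex.I * (Real.pi : ℝ))
        = Complex.exp ((n : ℂ) * Complex.I * (((-Real.pi : ℝ)) : ℂ)) * Complex.exp (n * (2 * Real.pi * Complex.I)) := by
          rw [← Complex.exp_add]; congr 1; push_cast; ring
      _ = Complex.exp ((n : ℂ) * Complex.I * (((-Real.pi : ℝ)) : ℂ)) := by rw [h, mul_one]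

/-- The four-dimensional exponential integral over the Brillouin zone:
`∫_{[−π,π]⁴} e^{i p·w} dp = (2π)⁴ [w = 0]` (Fubini over the coordinates). -/
theorem integral_brillouin_cexp_dot (w : Site 4) :
    ∫ p in brillouin, Complex.exp (((∑ μ : Fin 4, p μ * ((w μ : ℤ) : ℝ) : ℝ) : ℂ) * Complex.I) =
      if w = 0 then (((2 * Real.pi : ℝ)) : ℂ) ^ 4 else 0 := by
  have hprod : ∀ p : Fin 4 → ℝ, Complex.exp (((∑ μ : Fin 4, p μ * ((w μ : ℤ) : ℝ) : ℝ) : ℂ) * Complex.I) =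
      ∏ μ : Fin 4, Complex.exp ((((p μ * ((w μ : ℤ) : ℝ)) : ℝ) : ℂ) * Complex.I) := by
    intro p
    rw [← Complex.exp_sum]
    congr 1
    push_cast
    rw [Finset.sum_mul]
  simp_rw [hprod]
  rw [brillouin_eq, volume_pi, Measure.restrict_pi_pi,
    integral_fintype_prod_eq_prod (f := fun (μ : Fin 4) (x : ℝ) =>
      Complex.exp ((((x * ((w μ : ℤ) : ℝ)) : ℝ) : ℂ) * Complex.I))]
  have h1 : ∀ μ : Fin 4, ∫ x, Complex.exp ((((x * ((w μ : ℤ) : ℝ)) : ℝ) : ℂ) * Complex.I)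
      ∂((volume : Measure ℝ).restrict (Set.Icc (-Real.pi) Real.pi)) =
      if w μ = 0 then (((2 * Real.pi : ℝ)) : ℂ) else 0 := fun μ => integral_Icc_cexp_mul_int (w μ)
  simp_rw [h1]
  split_ifs with hw
  · subst hw
    simp
  · obtain ⟨μ, hμ⟩ : ∃ μ : Fin 4, w μ ≠ 0 := by
      by_contra h
      push Not at h
      exact hw (funext h)
    exact Finset.prod_eq_zero (Finset.mem_univ μ) (if_neg hμ)

/-- The cosine integral over the Brillouin zone: `∫_{[−π,π]⁴} cos(p·w) dp = (2π)⁴ [w = 0]`. -/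
theorem integral_brillouin_cos_dot (w : Site 4) :
    ∫ p in brillouin, Real.cos (∑ μ : Fin 4, p μ * ((w μ : ℤ) : ℝ)) =
      if w = 0 then (2 * Real.pi) ^ 4 else 0 := by
  have hcont : Continuous fun p : Fin 4 → ℝ =>
      Complex.exp (((∑ μ : Fin 4, p μ * ((w μ : ℤ) : ℝ) : ℝ) : ℂ) * Complex.I) := by
    have := continuous_dot w
    fun_prop
  have hint : Integrable (fun p : Fin 4 → ℝ =>
      Complex.exp (((∑ μ : Fin 4, p μ * ((w μ : ℤ) : ℝ) : ℝ) : ℂ) * Complex.I)) (volume.restrict brillouin) :=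
    hcont.continuousOn.integrableOn_compact isCompact_brillouin
  have key := integral_re hint
  simp only [RCLike.re_to_complex, Complex.exp_ofReal_mul_I_re] at key
  rw [key, integral_brillouin_cexp_dot]
  split_ifs
  · rw [← Complex.ofReal_pow, Complex.ofReal_re]
  · rw [Complex.zero_re]

/-- **Initial value** `k_0 = δ₀` (conjunct (3) of `FreeHeatCalculus`). -/
theorem freeKer_zero (w : Site 4) : freeKer 0 w = if w = 0 then 1 else 0 := by
  unfold freeKer
  simp only [zero_mul, neg_zero, Real.exp_zero, one_mul]
  rw [integral_brillouin_cos_dot]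
  split_ifs
  · exact norm_const_mul_volume
  · rw [mul_zero]

/-! ## §5 The lattice heat equation -/

/-- Differentiation under the integral sign for the Brillouin-zone integral. -/
theorem hasDerivAt_integral_freeIntegrand (t : ℝ) (w : Site 4) :
    HasDerivAt (fun s : ℝ => ∫ p in brillouin,
        Real.exp (-(s * hsymb p)) * Real.cos (∑ μ : Fin 4, p μ * ((w μ : ℤ) : ℝ)))
      (∫ p in brillouin,
        -(hsymb p * Real.exp (-(t * hsymb p))) * Real.cos (∑ μ : Fin 4, p μ * ((w μ : ℤ) : ℝ))) t := by
  have hF'cont : ∀ s : ℝ, Continuous fun p : Fin 4 → ℝ =>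
      -(hsymb p * Real.exp (-(s * hsymb p))) * Real.cos (∑ μ : Fin 4, p μ * ((w μ : ℤ) : ℝ)) := by
    intro s
    have := continuous_hsymb
    fun_prop
  refine (hasDerivAt_integral_of_dominated_loc_of_deriv_le (μ := volume.restrict brillouin)
    (F := fun (s : ℝ) (p : Fin 4 → ℝ) =>
      Real.exp (-(s * hsymb p)) * Real.cos (∑ μ : Fin 4, p μ * ((w μ : ℤ) : ℝ)))
    (F' := fun (s : ℝ) (p : Fin 4 → ℝ) =>
      -(hsymb p * Real.exp (-(s * hsymb p))) * Real.cos (∑ μ : Fin 4, p μ * ((w μ : ℤ) : ℝ)))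
    (bound := fun _ => 68 * Real.exp (68 * (|t| + 1)))
    (Metric.ball_mem_nhds t zero_lt_one) ?_ (integrableOn_freeIntegrand t w) ?_ ?_ ?_ ?_).2
  · exact Filter.Eventually.of_forall fun s => (continuous_freeIntegrand s w).aestronglyMeasurable
  · exact (hF'cont t).aestronglyMeasurable
  · refine ae_of_all _ fun p s hs => ?_
    have hs' : |s| ≤ |t| + 1 := by
      have : dist s t < 1 := hs
      rw [Real.dist_eq] at this
      have := abs_sub_abs_le_abs_sub s t
      linarith
    rw [Real.norm_eq_abs, abs_mul, abs_neg, abs_mul, abs_of_nonneg (hsymb_nonneg p), Real.abs_exp]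
    calc hsymb p * Real.exp (-(s * hsymb p)) * |Real.cos (∑ μ : Fin 4, p μ * ((w μ : ℤ) : ℝ))|
        ≤ 68 * Real.exp (68 * |s|) * 1 :=
          mul_le_mul (mul_le_mul (hsymb_le p) (exp_neg_mul_hsymb_le s p) (Real.exp_pos _).le (by norm_num))
            (Real.abs_cos_le_one _) (abs_nonneg _) (by positivity)
      _ ≤ 68 * Real.exp (68 * (|t| + 1)) := by
          rw [mul_one]
          exact mul_le_mul_of_nonneg_left (Real.exp_le_exp.mpr (by nlinarith)) (by norm_num)
  · exact integrableOn_const volume_brillouin_lt_top.ne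
  · refine ae_of_all _ fun p s _ => ?_
    have h1 : HasDerivAt (fun s : ℝ => -(s * hsymb p)) (-(1 * hsymb p)) s :=
      ((hasDerivAt_id s).mul_const (hsymb p)).neg
    have h2 := h1.exp.mul_const (Real.cos (∑ μ : Fin 4, p μ * ((w μ : ℤ) : ℝ)))
    refine h2.congr_deriv ?_
    ring

/-- **The lattice heat equation** `∂_t k_t(w) = −Σ_{z ∈ nbr2 0} ĥ(z) k_t(w − z)` (conjunct (4) of
`FreeHeatCalculus`), for every real `t`. -/
theorem hasDerivAt_freeKer (t : ℝ) (w : Site 4) :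
    HasDerivAt (fun s => freeKer s w) (-(∑ z ∈ nbr2 0, hhat z * freeKer t (w - z))) t := by
  have h := (hasDerivAt_integral_freeIntegrand t w).const_mul (((2 * Real.pi)⁻¹) ^ 4)
  have hfun : (fun s : ℝ => ((2 * Real.pi)⁻¹) ^ 4 * ∫ p in brillouin,
      Real.exp (-(s * hsymb p)) * Real.cos (∑ μ : Fin 4, p μ * ((w μ : ℤ) : ℝ))) = fun s => freeKer s w := by
    funext s; rfl
  rw [hfun] at h
  refine h.congr_deriv ?_
  -- identify the derivative
  have hpt : ∀ p : Fin 4 → ℝ,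
      -(hsymb p * Real.exp (-(t * hsymb p))) * Real.cos (∑ μ : Fin 4, p μ * ((w μ : ℤ) : ℝ)) =
      ∑ z ∈ nbr2 0, -(hhat z *
        (Real.exp (-(t * hsymb p)) * Real.cos (∑ μ : Fin 4, p μ * (((w - z) μ : ℤ) : ℝ)))) := by
    intro p
    have := hsymb_mul_cos p w
    calc -(hsymb p * Real.exp (-(t * hsymb p))) * Real.cos (∑ μ : Fin 4, p μ * ((w μ : ℤ) : ℝ))
        = -(Real.exp (-(t * hsymb p)) *
            (hsymb p * Real.cos (∑ μ : Fin 4, p μ * ((w μ : ℤ) : ℝ)))) := by ring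
      _ = -(Real.exp (-(t * hsymb p)) *
            ∑ z ∈ nbr2 0, hhat z * Real.cos (∑ μ : Fin 4, p μ * (((w - z) μ : ℤ) : ℝ))) := by rw [this]
      _ = ∑ z ∈ nbr2 0, -(hhat z *
            (Real.exp (-(t * hsymb p)) * Real.cos (∑ μ : Fin 4, p μ * (((w - z) μ : ℤ) : ℝ)))) := by
          rw [Finset.mul_sum, ← Finset.sum_neg_distrib]
          refine Finset.sum_congr rfl fun z _ => ?_
          ring
  simp_rw [hpt]
  rw [integral_finsetSum _ (fun z _ => ?_), Finset.mul_sum, ← Finset.sum_neg_distrib]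
  · refine Finset.sum_congr rfl fun z _ => ?_
    rw [integral_neg, integral_const_mul]
    unfold freeKer
    ring
  · exact ((integrableOn_freeIntegrand t (w - z)).const_mul (hhat z)).neg

/-- The free kernel is continuous in time. -/
theorem continuous_freeKer (w : Site 4) : Continuous fun t : ℝ => freeKer t w :=
  continuous_iff_continuousAt.mpr fun t => (hasDerivAt_freeKer t w).continuousAt

/-! ## Registered headline -/

/-- Registered headline of this helper file (aux stub `stub_freeHeatCalculusAuxD` of crux
stmt-QuantumFields-16786, line `Sketch`): the lattice heat equation of the free kernel. -/
theorem stub_freeHeatCalculusAuxD :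
    ∀ (t : ℝ) (w : Site 4),
      HasDerivAt (fun s => freeKer s w) (-(∑ z ∈ nbr2 0, hhat z * freeKer t (w - z))) t :=
  hasDerivAt_freeKer

end Summit.QuantumFields.QCD.Cruxes.QuarkLoopCoefficient.Sketch.FreeHeatCalculus

end
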